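import Mathlib
import Literature.Probability.Percolation.Percolation
import Literature.Probability.Percolation.DiagonalStripColumns
import Literature.Probability.Percolation.DiagonalColumnPatterns
import Literature.Probability.Percolation.DiagonalStripPlanarity
import Literature.Probability.Percolation.DiagonalStripTLAction
import HarnessLib

/-!
# The local relations of the layer update at an OLD site (case II of the interlacing mechanism)

Topic `Literature/Probability/Percolation`. Sequel to `DiagonalStripTLAction.lean` (case I: the two
edges at a NEW site). Here the two prescribed edges of the layer `c → c+1` sit at an OLD site `v`
(column `c`, level `i`), going to its two new neighbours `nL, nR` (levels `i ∓ 1`); the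
Temperley–Lieb generator `e_i` acts as `cpIsolate v` on the input column and as `cpJoin nL nR` on the
output column, and with `M_ε` the update with the fork edges `ε ∈ {o,c}²`:

* `IsForkSite`, `forkSiteEdges` (+`_apply`, `_false_false`), `patternOf_congr`, `patternOf_congr'`,
  `cpJoin_patternOf` (joining two new sites of a pattern read off `ρ` is `mergeRel ρ`);
* **`cpJoin_colUpdate_fork`**: `join ∘ M_ε = M_oo` for `ε ≠ cc`;
* detaching an untouched old site: `cpClassRep`, **`eqvGen_updRel_cpIsolate_pull`** (for a VALID
  pattern the update closure is carried into the closure of the isolated pattern by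
  `inl v ↦ inl (cpClassRep P v)`), `eqvGen_updRel_cpIsolate_inr_iff`, `exists_wall_cpIsolate_iff`;
* **`colUpdate_cpIsolate_fork_not_both`**: `M_ε ∘ iso_v = M_cc` for `ε ≠ oo` (valid input);
* **`colUpdate_cpIsolate_fork_open_open`**: `M_oo ∘ iso_v = join ∘ M_cc` (valid input).

Together with case I these are all the operator relations needed to push `Ř_i(x)` through one row
of Ikhlef–Ponsaing's transfer matrix (J. Stat. Phys. 149 (2012), arXiv:1202.5476, Lemma 3.2) in
the cluster language; the scalar identities of the tile weights and the summation are for a sequel.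

## References

* Y. Ikhlef, A. K. Ponsaing, J. Stat. Phys. 149 (2012) 10–36, arXiv:1202.5476, §3.1, Lemma 3.2.
  [IkhlefPonsaing2012]
-/

namespace Literature.Probability.Percolation

open Relation

variable {m : ℕ}

/-! ### Case (II): the two edges at an OLD site (a fork) -/

section Fork

variable {c : ℤ} {P : ColPattern m} {E : Fin (m + 1) → Fin (m + 1) → Bool} {v nL nR : Fin (m + 1)}

/-- **A fork site**: the old site `v` has the two new neighbours `nL ≠ nR`, and the layer `E` has NO
edge at `v` (the two edges at `v` are prescribed separately). [folklore] -/
structure IsForkSite (E : Fin (m + 1) → Fin (m + 1) → Bool) (v nL nR : Fin (m + 1)) : Prop where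
  ne : nL ≠ nR
  noEdge : ∀ j', E v j' = false

/-- The layer with the two edges at the old site `v` set to `bL, bR`. [folklore] -/
def forkSiteEdges (E : Fin (m + 1) → Fin (m + 1) → Bool) (v nL nR : Fin (m + 1)) (bL bR : Bool) :
    Fin (m + 1) → Fin (m + 1) → Bool :=
  setEdge (setEdge E v nL bL) v nR bR

/-- The edges of the fork layer. [folklore] -/
theorem forkSiteEdges_apply (hF : IsForkSite E v nL nR) (bL bR : Bool) (i j' : Fin (m + 1)) :
    forkSiteEdges E v nL nR bL bR i j' = true ↔
      (i ≠ v ∧ E i j' = true) ∨ (i = v ∧ j' = nL ∧ bL = true) ∨ (i = v ∧ j' = nR ∧ bR = true) := by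
  unfold forkSiteEdges setEdge
  by_cases h1 : i = v ∧ j' = nR
  · obtain ⟨rfl, rfl⟩ := h1
    simp [hF.ne.symm]
  · rw [if_neg h1]
    by_cases h2 : i = v ∧ j' = nL
    · obtain ⟨rfl, rfl⟩ := h2
      simp [hF.ne]
    · rw [if_neg h2]
      by_cases hi : i = v
      · subst hi
        have hj1 : j' ≠ nR := fun h => h1 ⟨rfl, h⟩
        have hj2 : j' ≠ nL := fun h => h2 ⟨rfl, h⟩
        simp [hF.noEdge j', hj1, hj2]
      · simp [hi]

/-- The all-closed fork layer is the layer itself. [folklore] -/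
theorem forkSiteEdges_false_false (hF : IsForkSite E v nL nR) : forkSiteEdges E v nL nR false false = E := by
  funext i j'
  rw [Bool.eq_iff_iff, forkSiteEdges_apply hF]
  simp only [Bool.false_eq_true, and_false, or_false]
  constructor
  · rintro ⟨-, h⟩; exact h
  · intro h
    refine ⟨?_, h⟩
    rintro rfl
    simp [hF.noEdge] at h

/-- Patterns read off pointwise-equivalent data agree. [folklore] -/
theorem patternOf_congr {ρ ρ' : Fin (m + 1) ⊕ Fin (m + 1) → Fin (m + 1) ⊕ Fin (m + 1) → Prop}
    {W W' : Fin (m + 1) ⊕ Fin (m + 1) → Prop}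
    (hρ : ∀ x y, ρ (Sum.inr x) y ↔ ρ' (Sum.inr x) y) (hW : ∀ z, W z ↔ W' z) :
    patternOf ρ W = patternOf ρ' W' := by
  classical
  unfold patternOf
  congr 1
  · funext x y; rw [decide_eq_decide]; exact hρ x _
  · funext x; rw [decide_eq_decide]
    exact exists_congr fun z => and_congr (hρ x z) (hW z)

/-- **Joining two new sites of a pattern read off an equivalence is `mergeRel`.** [folklore] -/
theorem cpJoin_patternOf {ρ : Fin (m + 1) ⊕ Fin (m + 1) → Fin (m + 1) ⊕ Fin (m + 1) → Prop}
    (W : Fin (m + 1) ⊕ Fin (m + 1) → Prop) (a b : Fin (m + 1)) :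
    cpJoin a b (patternOf ρ W) = patternOf (mergeRel ρ (Sum.inr a) (Sum.inr b)) W := by
  classical
  refine Prod.ext (funext fun x => funext fun y => ?_) (funext fun x => ?_)
  · rw [Bool.eq_iff_iff, cpJoin_fst_eq_true_iff]
    simp only [patternOf, decide_eq_true_eq, mergeRel]
  · rw [Bool.eq_iff_iff, cpJoin_snd_eq_true_iff]
    simp only [patternOf, decide_eq_true_eq, mergeRel]
    constructor
    · rintro (⟨z, hz, hw⟩ | ⟨h1, z, hz, hw⟩ | ⟨h1, z, hz, hw⟩)
      · exact ⟨z, Or.inl hz, hw⟩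
      · exact ⟨z, Or.inr (Or.inl ⟨h1, hz⟩), hw⟩
      · exact ⟨z, Or.inr (Or.inr ⟨h1, hz⟩), hw⟩
    · rintro ⟨z, hz | ⟨h1, h2⟩ | ⟨h1, h2⟩, hw⟩
      · exact Or.inl ⟨z, hz, hw⟩
      · exact Or.inr (Or.inl ⟨h1, z, h2, hw⟩)
      · exact Or.inr (Or.inr ⟨h1, z, h2, hw⟩)

/-- The update relation of the fork layer: the base relation plus the open fork edges. [folklore] -/
theorem eqvGen_updRel_forkSiteEdges_iff (hF : IsForkSite E v nL nR) (P : ColPattern m) (bL bR : Bool)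
    (x y : Fin (m + 1) ⊕ Fin (m + 1)) :
    EqvGen (updRel m P (forkSiteEdges E v nL nR bL bR)) x y ↔
      EqvGen (fun x y => (updRel m P E x y ∨ (bL = true ∧ x = Sum.inl v ∧ y = Sum.inr nL)) ∨
        (bR = true ∧ x = Sum.inl v ∧ y = Sum.inr nR)) x y := by
  refine eqvGen_iff_eqvGen (fun x y h => ?_) (fun x y h => ?_) x y
  · rcases x with i | j₁ <;> rcases y with i' | j₂
    · exact EqvGen.rel _ _ (Or.inl (Or.inl h))
    · simp only [updRel] at h
      rcases (forkSiteEdges_apply hF bL bR i j₂).1 h with ⟨-, h⟩ | ⟨hi, hj, hb⟩ | ⟨hi, hj, hb⟩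
      · exact EqvGen.rel _ _ (Or.inl (Or.inl h))
      · rw [hi, hj]; exact EqvGen.rel _ _ (Or.inl (Or.inr ⟨hb, rfl, rfl⟩))
      · rw [hi, hj]; exact EqvGen.rel _ _ (Or.inr ⟨hb, rfl, rfl⟩)
    · simp only [updRel] at h
      rcases (forkSiteEdges_apply hF bL bR i' j₁).1 h with ⟨-, h⟩ | ⟨hi, hj, hb⟩ | ⟨hi, hj, hb⟩
      · exact EqvGen.rel _ _ (Or.inl (Or.inl (show updRel m P E _ _ from h)))
      · rw [hi, hj]; exact EqvGen.symm _ _ (EqvGen.rel _ _ (Or.inl (Or.inr ⟨hb, rfl, rfl⟩)))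
      · rw [hi, hj]; exact EqvGen.symm _ _ (EqvGen.rel _ _ (Or.inr ⟨hb, rfl, rfl⟩))
    · exact absurd h id
  · rcases h with (h | ⟨hb, rfl, rfl⟩) | ⟨hb, rfl, rfl⟩
    · refine EqvGen.rel _ _ ?_
      rcases x with i | j₁ <;> rcases y with i' | j₂ <;> simp only [updRel] at h ⊢
      · exact h
      · exact (forkSiteEdges_apply hF bL bR i j₂).2 (Or.inl ⟨fun h' => by subst h'; simp [hF.noEdge] at h, h⟩)
      · exact (forkSiteEdges_apply hF bL bR i' j₁).2 (Or.inl ⟨fun h' => by subst h'; simp [hF.noEdge] at h, h⟩)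
    · exact EqvGen.rel _ _ (show updRel m P _ _ _ from (forkSiteEdges_apply hF bL bR v nL).2
        (Or.inr (Or.inl ⟨rfl, rfl, hb⟩)))
    · exact EqvGen.rel _ _ (show updRel m P _ _ _ from (forkSiteEdges_apply hF bL bR v nR).2
        (Or.inr (Or.inr ⟨rfl, rfl, hb⟩)))

/-- In the fully open fork closure the two new neighbours are related (through `v`). [folklore] -/
theorem eqvGen_fork_open_open_LR (hF : IsForkSite E v nL nR) (P : ColPattern m) :
    EqvGen (updRel m P (forkSiteEdges E v nL nR true true)) (Sum.inr nL) (Sum.inr nR) := by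
  have h1 : updRel m P (forkSiteEdges E v nL nR true true) (Sum.inl v) (Sum.inr nL) :=
    (forkSiteEdges_apply hF true true v nL).2 (Or.inr (Or.inl ⟨rfl, rfl, rfl⟩))
  have h2 : updRel m P (forkSiteEdges E v nL nR true true) (Sum.inl v) (Sum.inr nR) :=
    (forkSiteEdges_apply hF true true v nR).2 (Or.inr (Or.inr ⟨rfl, rfl, rfl⟩))
  exact EqvGen.trans _ _ _ (EqvGen.symm _ _ (EqvGen.rel _ _ h1)) (EqvGen.rel _ _ h2)

/-- **`join ∘ M_ε = M_oo`** at a fork, for `ε ≠ cc`: after opening at least one fork edge, joining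
the two new neighbours updates like opening both. [cite: IkhlefPonsaing2012, Lemma 3.2] -/
theorem cpJoin_colUpdate_fork (hF : IsForkSite E v nL nR) (bL bR : Bool) (hb : bL = true ∨ bR = true) :
    cpJoin nL nR (colUpdate m c P (forkSiteEdges E v nL nR bL bR)) =
      colUpdate m c P (forkSiteEdges E v nL nR true true) := by
  classical
  rw [colUpdate_eq_patternOf, colUpdate_eq_patternOf, cpJoin_patternOf]
  have hρ := EqvGen.is_equivalence (updRel m P (forkSiteEdges E v nL nR bL bR))
  refine patternOf_congr (fun x y => ?_) (fun z => Iff.rfl)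
  -- `mergeRel (closure_b) nL nR = closure_tt`
  have key : ∀ x y, mergeRel (EqvGen (updRel m P (forkSiteEdges E v nL nR bL bR))) (Sum.inr nL) (Sum.inr nR) x y ↔
      EqvGen (updRel m P (forkSiteEdges E v nL nR true true)) x y := by
    intro x y
    rw [← eqvGen_insert_iff_mergeRel]
    refine eqvGen_iff_eqvGen (fun x y h => ?_) (fun x y h => ?_) x y
    · rcases h with h | ⟨rfl, rfl⟩
      · refine EqvGen.rel _ _ (updRel_mono_edges (fun i j' h => ?_) P x y h)
        rcases (forkSiteEdges_apply hF bL bR i j').1 h with h | ⟨h1, h2, -⟩ | ⟨h1, h2, -⟩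
        · exact (forkSiteEdges_apply hF true true i j').2 (Or.inl h)
        · exact (forkSiteEdges_apply hF true true i j').2 (Or.inr (Or.inl ⟨h1, h2, rfl⟩))
        · exact (forkSiteEdges_apply hF true true i j').2 (Or.inr (Or.inr ⟨h1, h2, rfl⟩))
      · exact eqvGen_fork_open_open_LR hF P
    · -- generators of the open side: base edges, or the two fork edges
      have hvL : EqvGen (fun x y => updRel m P (forkSiteEdges E v nL nR bL bR) x y ∨
          (x = Sum.inr nL ∧ y = Sum.inr nR)) (Sum.inl v) (Sum.inr nL) := by
        rcases hb with hb | hb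
        · exact EqvGen.rel _ _ (Or.inl (show updRel m P _ _ _ from
            (forkSiteEdges_apply hF bL bR v nL).2 (Or.inr (Or.inl ⟨rfl, rfl, hb⟩))))
        · exact EqvGen.trans _ (Sum.inr nR) _ (EqvGen.rel _ _ (Or.inl
            (show updRel m P _ (Sum.inl v) (Sum.inr nR) from
              (forkSiteEdges_apply hF bL bR v nR).2 (Or.inr (Or.inr ⟨rfl, rfl, hb⟩)))))
            (EqvGen.symm _ _ (EqvGen.rel _ _ (Or.inr ⟨rfl, rfl⟩)))
      have hvR : EqvGen (fun x y => updRel m P (forkSiteEdges E v nL nR bL bR) x y ∨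
          (x = Sum.inr nL ∧ y = Sum.inr nR)) (Sum.inl v) (Sum.inr nR) :=
        EqvGen.trans _ _ _ hvL (EqvGen.rel _ _ (Or.inr ⟨rfl, rfl⟩))
      rcases x with i | j₁ <;> rcases y with i' | j₂ <;> simp only [updRel] at h
      · exact EqvGen.rel _ _ (Or.inl h)
      · rcases (forkSiteEdges_apply hF true true i j₂).1 h with ⟨h1, h2⟩ | ⟨hi, hj, -⟩ | ⟨hi, hj, -⟩
        · exact EqvGen.rel _ _ (Or.inl (show updRel m P _ _ _ from
            (forkSiteEdges_apply hF bL bR i j₂).2 (Or.inl ⟨h1, h2⟩)))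
        · rw [hi, hj]; exact hvL
        · rw [hi, hj]; exact hvR
      · rcases (forkSiteEdges_apply hF true true i' j₁).1 h with ⟨h1, h2⟩ | ⟨hi, hj, -⟩ | ⟨hi, hj, -⟩
        · exact EqvGen.rel _ _ (Or.inl (show updRel m P _ _ _ from
            (forkSiteEdges_apply hF bL bR i' j₁).2 (Or.inl ⟨h1, h2⟩)))
        · rw [hi, hj]; exact EqvGen.symm _ _ hvL
        · rw [hi, hj]; exact EqvGen.symm _ _ hvR
  exact key _ _

end Fork

/-! ### Case (II) continued: isolating the old site first (detaching an untouched old site) -/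

section Detach

variable {c : ℤ} {P : ColPattern m} {E : Fin (m + 1) → Fin (m + 1) → Bool} {v : Fin (m + 1)}

/-- A point touched only by loops is a singleton class of the closure. [folklore] -/
theorem eqvGen_isolated_iff' {V : Type*} {r : V → V → Prop} {j : V}
    (hj : ∀ y, (r j y → y = j) ∧ (r y j → y = j)) (y : V) : EqvGen r j y ↔ y = j := by
  constructor
  · suffices H : ∀ a b, EqvGen r a b → (a = j ↔ b = j) from fun h => ((H _ _ h).1 rfl).symm ▸ rfl
    intro a b hab
    induction hab with
    | rel a b h =>
      constructor
      · rintro rfl; exact (hj b).1 h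
      · rintro rfl; exact (hj a).2 h
    | refl a => exact Iff.rfl
    | symm a b _ ih => exact ih.symm
    | trans a b c _ _ ih1 ih2 => exact ih1.trans ih2
  · rintro rfl; exact EqvGen.refl _

/-- After isolating `v` (no edge at `v`), `inl v` is a singleton class of the update closure. [folklore] -/
theorem eqvGen_updRel_cpIsolate_inl_iff (hE : ∀ j', E v j' = false) (y : Fin (m + 1) ⊕ Fin (m + 1)) :
    EqvGen (updRel m (cpIsolate v P) E) (Sum.inl v) y ↔ y = Sum.inl v := by
  refine eqvGen_isolated_iff' (fun y => ?_) y
  rcases y with i | j'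
  · simp only [updRel, cpIsolate_fst_eq_true_iff, ne_eq, not_true_eq_false, false_and, and_false,
      or_false, Sum.inl.injEq]
    exact ⟨fun h => h.symm, fun h => h⟩
  · simp [updRel, hE]

/-- The isolated side generates less. [folklore] -/
theorem eqvGen_updRel_cpIsolate_le (x y : Fin (m + 1) ⊕ Fin (m + 1))
    (h : EqvGen (updRel m (cpIsolate v P) E) x y) : EqvGen (updRel m P E) x y := by
  refine eqvGen_le_eqvGen (fun x y h => ?_) x y h
  rcases x with i | j₁ <;> rcases y with i' | j₂ <;> simp only [updRel] at h
  · rw [cpIsolate_fst_eq_true_iff] at h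
    rcases h with rfl | ⟨-, -, h⟩
    · exact EqvGen.refl _
    · exact EqvGen.rel (Sum.inl i) (Sum.inl i') h
  · exact EqvGen.rel (Sum.inl i) (Sum.inr j₂) h
  · exact EqvGen.rel (Sum.inr j₁) (Sum.inl i') h

open Classical in
/-- A representative of the class of `v` other than `v` (or `v` itself if the class is `{v}`). [folklore] -/
noncomputable def cpClassRep (P : ColPattern m) (v : Fin (m + 1)) : Fin (m + 1) :=
  if h : ∃ i, i ≠ v ∧ P.1 v i = true then h.choose else v

/-- The defining property of `cpClassRep`. [folklore] -/
theorem cpClassRep_spec (P : ColPattern m) (v : Fin (m + 1)) (h : ∃ i, i ≠ v ∧ P.1 v i = true) :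
    cpClassRep P v ≠ v ∧ P.1 v (cpClassRep P v) = true := by
  unfold cpClassRep; rw [dif_pos h]; exact h.choose_spec

/-- **Detaching an untouched old site.** For a valid pattern and a layer with no edge at `v`, the
update closure is carried into the closure of the isolated pattern by `inl v ↦ inl (cpClassRep P v)`. [folklore] -/
theorem eqvGen_updRel_cpIsolate_pull (hP : IsValid c P) (hE : ∀ j', E v j' = false)
    (x y : Fin (m + 1) ⊕ Fin (m + 1)) (h : EqvGen (updRel m P E) x y) :
    EqvGen (updRel m (cpIsolate v P) E)
      (if x = Sum.inl v then Sum.inl (cpClassRep P v) else x)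
      (if y = Sum.inl v then Sum.inl (cpClassRep P v) else y) := by
  -- an `L`-generator between two old sites both different from `v`
  have gen : ∀ a b : Fin (m + 1), a ≠ v → b ≠ v → P.1 a b = true →
      EqvGen (updRel m (cpIsolate v P) E) (Sum.inl a) (Sum.inl b) := fun a b ha hb h =>
    EqvGen.rel (Sum.inl a) (Sum.inl b) (show updRel m (cpIsolate v P) E _ _ by
      simp only [updRel]; rw [cpIsolate_fst_eq_true_iff]; exact Or.inr ⟨ha, hb, h⟩)
  -- the representative is related to every member of the class of `v` other than `v`
  have rep : ∀ b : Fin (m + 1), b ≠ v → P.1 v b = true →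
      EqvGen (updRel m (cpIsolate v P) E) (Sum.inl (cpClassRep P v)) (Sum.inl b) := by
    intro b hb h
    obtain ⟨h1, h2⟩ := cpClassRep_spec P v ⟨b, hb, h⟩
    exact gen _ _ h1 hb (hP.trans _ _ _ (hP.symm _ _ h2) h)
  induction h with
  | rel x y h =>
    rcases x with a | j₁ <;> rcases y with b | j₂ <;> simp only [updRel] at h
    · by_cases ha : a = v <;> by_cases hb : b = v
      · subst ha; subst hb; exact EqvGen.refl _
      · subst ha
        rw [if_pos rfl, if_neg (by simpa using hb)]
        exact rep b hb h
      · subst hb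
        rw [if_neg (by simpa using ha), if_pos rfl]
        exact EqvGen.symm _ _ (rep a ha (hP.symm _ _ h))
      · rw [if_neg (by simpa using ha), if_neg (by simpa using hb)]
        exact gen a b ha hb h
    · have ha : a ≠ v := by rintro rfl; simp [hE] at h
      rw [if_neg (by simpa using ha), if_neg (by simp)]
      exact EqvGen.rel (Sum.inl a) (Sum.inr j₂) h
    · have hb : b ≠ v := by rintro rfl; simp [hE] at h
      rw [if_neg (by simp), if_neg (by simpa using hb)]
      exact EqvGen.rel (Sum.inr j₁) (Sum.inl b) h
  | refl x => exact EqvGen.refl _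
  | symm x y _ ih => exact EqvGen.symm _ _ ih
  | trans x y z _ _ ih1 ih2 => exact EqvGen.trans _ _ _ ih1 ih2

/-- **Detaching does not change the connectivity of the new sites.** [folklore] -/
theorem eqvGen_updRel_cpIsolate_inr_iff (hP : IsValid c P) (hE : ∀ j', E v j' = false)
    (x : Fin (m + 1)) (y : Fin (m + 1) ⊕ Fin (m + 1)) (hy : y ≠ Sum.inl v) :
    EqvGen (updRel m (cpIsolate v P) E) (Sum.inr x) y ↔ EqvGen (updRel m P E) (Sum.inr x) y := by
  refine ⟨eqvGen_updRel_cpIsolate_le _ _, fun h => ?_⟩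
  have := eqvGen_updRel_cpIsolate_pull hP hE _ _ h
  rwa [if_neg (by simp), if_neg hy] at this

/-- **Detaching does not change which new sites see the wall.** [folklore] -/
theorem exists_wall_cpIsolate_iff (hP : IsValid c P) (hE : ∀ j', E v j' = false) (x : Fin (m + 1)) :
    (∃ z, EqvGen (updRel m (cpIsolate v P) E) (Sum.inr x) z ∧ updWall m c (cpIsolate v P) z) ↔
      (∃ z, EqvGen (updRel m P E) (Sum.inr x) z ∧ updWall m c P z) := by
  constructor
  · rintro ⟨z, hz, hw⟩
    refine ⟨z, eqvGen_updRel_cpIsolate_le _ _ hz, ?_⟩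
    rcases z with i | j'
    · simp only [updWall] at hw ⊢
      rw [cpIsolate_snd_eq_true_iff] at hw
      exact hw.2
    · exact hw
  · rintro ⟨z, hz, hw⟩
    have h := eqvGen_updRel_cpIsolate_pull (v := v) hP hE _ _ hz
    rw [if_neg (by simp)] at h
    by_cases hzv : z = Sum.inl v
    · subst hzv
      rw [if_pos rfl] at h
      simp only [updWall] at hw
      by_cases hcl : ∃ i, i ≠ v ∧ P.1 v i = true
      · obtain ⟨h1, h2⟩ := cpClassRep_spec P v hcl
        refine ⟨_, h, ?_⟩
        simp only [updWall]
        rw [cpIsolate_snd_eq_true_iff]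
        exact ⟨h1, hP.wall _ _ h2 hw⟩
      · -- the class of `v` is `{v}`: then `inr x` cannot reach `inl v`
        have hrep : cpClassRep P v = v := by unfold cpClassRep; rw [dif_neg hcl]
        rw [hrep] at h
        exact absurd ((eqvGen_updRel_cpIsolate_inl_iff hE _).1 (EqvGen.symm _ _ h)) (by simp)
    · rw [if_neg hzv] at h
      refine ⟨z, h, ?_⟩
      rcases z with i | j'
      · simp only [updWall] at hw ⊢
        rw [cpIsolate_snd_eq_true_iff]
        exact ⟨fun h' => hzv (by rw [h']), hw⟩
      · exact hw

end Detach

/-- Patterns read off data that agree on new sites and on wall visibility coincide. [folklore] -/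
theorem patternOf_congr' {ρ ρ' : Fin (m + 1) ⊕ Fin (m + 1) → Fin (m + 1) ⊕ Fin (m + 1) → Prop}
    {W W' : Fin (m + 1) ⊕ Fin (m + 1) → Prop}
    (h1 : ∀ x y : Fin (m + 1), ρ (Sum.inr x) (Sum.inr y) ↔ ρ' (Sum.inr x) (Sum.inr y))
    (h2 : ∀ x : Fin (m + 1), (∃ z, ρ (Sum.inr x) z ∧ W z) ↔ (∃ z, ρ' (Sum.inr x) z ∧ W' z)) :
    patternOf ρ W = patternOf ρ' W' := by
  classical
  unfold patternOf
  congr 1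
  · funext x y; rw [decide_eq_decide]; exact h1 x y
  · funext x; rw [decide_eq_decide]; exact h2 x

section Fork2

variable {c : ℤ} {P : ColPattern m} {E : Fin (m + 1) → Fin (m + 1) → Bool} {v nL nR : Fin (m + 1)}

/-- The fork closure after isolating `v`: `mergeRel` of the detached closure with the attachment
point (`inr nL`, `inr nR`, or `inl v` itself when both fork edges are closed). [folklore] -/
theorem eqvGen_updRel_cpIsolate_fork_iff (hF : IsForkSite E v nL nR) (bL bR : Bool)
    (hb : ¬ (bL = true ∧ bR = true)) (x y : Fin (m + 1) ⊕ Fin (m + 1)) :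
    EqvGen (updRel m (cpIsolate v P) (forkSiteEdges E v nL nR bL bR)) x y ↔
      mergeRel (EqvGen (updRel m (cpIsolate v P) E)) (Sum.inl v)
        (if bL = true then Sum.inr nL else if bR = true then Sum.inr nR else Sum.inl v) x y := by
  rw [← eqvGen_insert_iff_mergeRel, eqvGen_updRel_forkSiteEdges_iff hF]
  have key : (fun x y => (updRel m (cpIsolate v P) E x y ∨ (bL = true ∧ x = Sum.inl v ∧ y = Sum.inr nL)) ∨
      (bR = true ∧ x = Sum.inl v ∧ y = Sum.inr nR)) =
      fun x y => updRel m (cpIsolate v P) E x y ∨ (x = Sum.inl v ∧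
        y = if bL = true then Sum.inr nL else if bR = true then Sum.inr nR else Sum.inl v) := by
    funext x y
    cases bL <;> cases bR
    · simp only [Bool.false_eq_true, false_and, or_false, if_false, eq_iff_iff]
      constructor
      · exact Or.inl
      · rintro (h | ⟨rfl, rfl⟩)
        · exact h
        · exact (show (cpIsolate v P).1 v v = true by rw [cpIsolate_fst_eq_true_iff]; exact Or.inl rfl)
    · simp
    · simp
    · exact absurd ⟨rfl, rfl⟩ hb
  rw [key]

/-- **`M_ε ∘ iso_v = M_cc`** at a fork, for `ε ≠ oo`: isolating the old site first and opening at most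
one fork edge updates like the plain layer. [cite: IkhlefPonsaing2012, Lemma 3.2] -/
theorem colUpdate_cpIsolate_fork_not_both (hF : IsForkSite E v nL nR) (hP : IsValid c P) (bL bR : Bool)
    (hb : ¬ (bL = true ∧ bR = true)) :
    colUpdate m c (cpIsolate v P) (forkSiteEdges E v nL nR bL bR) = colUpdate m c P E := by
  classical
  rw [colUpdate_eq_patternOf, colUpdate_eq_patternOf]
  set t : Fin (m + 1) ⊕ Fin (m + 1) :=
    if bL = true then Sum.inr nL else if bR = true then Sum.inr nR else Sum.inl v with ht
  have hσv : ∀ y, EqvGen (updRel m (cpIsolate v P) E) (Sum.inl v) y ↔ y = Sum.inl v :=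
    eqvGen_updRel_cpIsolate_inl_iff hF.noEdge
  have hE := EqvGen.is_equivalence (updRel m (cpIsolate v P) E)
  have hxv : ∀ x : Fin (m + 1), ¬ EqvGen (updRel m (cpIsolate v P) E) (Sum.inr x) (Sum.inl v) :=
    fun x h => by simpa using (hσv _).1 (hE.symm h)
  refine patternOf_congr' (fun x y => ?_) (fun x => ?_)
  · rw [eqvGen_updRel_cpIsolate_fork_iff hF bL bR hb, ← ht]
    simp only [mergeRel]
    rw [← eqvGen_updRel_cpIsolate_inr_iff hP hF.noEdge x (Sum.inr y) (by simp)]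
    constructor
    · rintro (h | ⟨h1, -⟩ | ⟨-, h2⟩)
      · exact h
      · exact absurd h1 (hxv x)
      · have := (hσv _).1 h2; simp at this
    · exact Or.inl
  · rw [← exists_wall_cpIsolate_iff (v := v) hP hF.noEdge x]
    simp only [eqvGen_updRel_cpIsolate_fork_iff hF bL bR hb, ← ht, mergeRel]
    constructor
    · rintro ⟨z, h | ⟨h1, -⟩ | ⟨-, h2⟩, hw⟩
      · exact ⟨z, h, hw⟩
      · exact absurd h1 (hxv x)
      · have := (hσv _).1 h2
        subst this
        simp [updWall, cpIsolate_snd_eq_true_iff] at hw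
    · rintro ⟨z, h, hw⟩
      exact ⟨z, Or.inl h, hw⟩

/-- **`M_oo ∘ iso_v = join ∘ M_cc`** at a fork: isolating the old site first and opening both fork edges
updates like the plain layer followed by joining the two new neighbours. [cite: IkhlefPonsaing2012, Lemma 3.2] -/
theorem colUpdate_cpIsolate_fork_open_open (hF : IsForkSite E v nL nR) (hP : IsValid c P) :
    colUpdate m c (cpIsolate v P) (forkSiteEdges E v nL nR true true) =
      cpJoin nL nR (colUpdate m c P E) := by
  classical
  -- go through `M_oc ∘ iso` using `join ∘ M_oc = M_oo` on the isolated side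
  have hF' : IsForkSite E v nL nR := hF
  rw [← cpJoin_colUpdate_fork (P := cpIsolate v P) hF' true false (Or.inl rfl),
    colUpdate_cpIsolate_fork_not_both hF hP true false (by simp)]

end Fork2

end Literature.Probability.Percolation
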